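/-
Origin: expansion seat `planner-pub-hodgecm-toy-g3-0`, handover #1 2026-08-18T11:20:03Z (`HOME/pub-hodgecm-toy-g3/lean/ToyG3/CupFacts3.lean`, md5 ef9c10c7, 173 lines);
landed by the gen-8 packager in gate run 29 as `HodgeCM/Model/ToyG2/CupFacts3.lean` (verbatim).
-/
/-
Copyright: pub-hodgecm formalisation cell (harness21, 2026). New file (not vendored).
Origin: session planner-pub-hodgecm-toy-g3-0 (unit pub-hodgecm-toy-g3, EXPANSION part (e) CONSISTENCY WITNESS, gen 3 of the
lineage toy → toy-g2 → toy-g3), 2026-08-18.  WIP module `ToyG3.CupFacts3`; intended final place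
`HodgeCM/Model/ToyG2/CupFacts3.lean` (module `HodgeCM.Model.ToyG2.CupFacts3`; kind L5, toy model / consistency witness —
ONE NEW ADDITIVE FILE, no landed file is touched).  Imports are FINAL package names (all in the tree since gate run 26);
nothing to rewrite.
-/
import Mathlib
import Summits.HodgeConjecture.HodgeCM.Model.ToyG2.Universe3
import Summits.HodgeConjecture.HodgeCM.Model.Toy.PohlmannBasis

/-!
# N1–N4, Pohlmann's theorem and [QW8] sufficiency in the generation-2 toy universe on good objects

`HodgeCM.Model.Toy.CupFacts` (pohl-g4, gate run 22) proves the four textbook cup-product facts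

* N1 `Fact_cupExterior` — `⋀^{k+1} H¹ ≅ H^{k+1}` via the iterated cup product (CM products),
* N2 `Fact_cup_hodge`   — `F^p H^i ∪ F^q H^j ⊆ F^{p+q} H^{i+j}`,
* N3 `Fact_pull_H0`     — `f^* = id` on `H⁰`,
* N4 `Fact_hodge_F0`    — `F⁰ H^k = H^k`

in the generation-1 exterior CM-model `toyModelWith D` (objects `Obj`), whence `PohlmannSpan`, `PohlmannBasis`,
`PohlmannTheorem31` (`HodgeCM.Model.Toy.PohlmannBasis`) and `Qw8Sufficiency` (`HodgeCM.Model.Toy.ToyOpenInputs`, toy2-g2)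
hold in `toyModel` under its model axioms.  That model has ALL PERIODS ZERO, so both theta-realisation inputs fail in it
(`HodgeCM.Toy.toyModel_openInputs_iff`, `toyModel_isEmpty_thetaRealisation`).

The generation-2 universe `HodgeCM.ToyG2.toyModel3With D T pl` (toy-g2, `Universe3`, gate run 26) — good objects `GObj`
(CM atoms and Picard blocks with a genuine trace), `H^k(X) = ⋀^k L(X)` on the expanded object `X.X.toObj : Obj`, cup = wedge,
`alg :=` Hodge classes — carries NONEMPTY theta realisations (`HodgeCM.ToyG2.ThetaUiso.realisationExistsPerL₃ / Face₃`,
pv03-g5 `ThetaModel3`, gate run 27).  This file transports N1–N4 to it — every field of `toyModel3With` that the four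
facts mention is, on `X`, the corresponding field of `toyModelWith D` on `X.X.toObj` (by `rfl`; for N1 after an
induction on the number of cup factors, `cupPow₃_eq`) — and concludes, for every trace system `T` and every good
block assignment `pl`, under the model axioms `M` of the universe:

* `fact3_cupExterior`, `fact3_cup_hodge`, `fact3_pull_H0`, `fact3_hodge_F0` (N1–N4; no hypothesis);
* `toyModel3_weightSpan M`, `toyModel3_weightHodge M` (M29, M30);
* `toyModel3_pohlmannSpan M`, `toyModel3_pohlmannBasis M`, `toyModel3_pohlmannTheorem31 M` (Pohlmann's theorem, all
  three typed forms: `Universe.pohlmannSpan_of_facts` / `pohlmannBasis_of_facts` / `pohlmannTheorem31_of_facts`);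
* `toyModel3_qw8Sufficiency M` ([QW8] Thm 2.5 sufficiency: `alg =` Hodge classes and `PohlmannBasis` put every weight
  vector of a Hodge weight inside `algC`; the Lefschetz-character hypothesis is not used — as in toy2-g2's gen-1 proof);
* `toyModel3_openInputs_iff M : OpenInputs ↔ (RealisationExistsPerL ∧ RealisationExistsFace)` — in this universe too
  the record of open inputs is located exactly at the two realisation statements; they are supplied (for
  `toyUniverse₃ d t`, `1 ≤ d`, `t² = 16`) in `HodgeCM.Model.ToyG2.OpenInputs3`.

Everything is kernel-proved from the tree; no citation, nothing posited.  (Referee A item G4, consistency witness: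
this is the CM-side half of the JOINT witness `∃ U, U.ModelAxioms ∧ U.OpenInputs` of `OpenInputs3` / `OpenInputsAll3`.)
-/

noncomputable section

open scoped TensorProduct
open exteriorPower

namespace HodgeCM.ToyG2

open HodgeCM.Toy
open Literature.AlgebraicGeometry.Motives (CMType)

variable (D : HodgeData) (T : TraceSys) (pl : GBlocks)

/-! ### N3 and N4 -/

/-- **N3 in `toyModel3With D T pl`** (any Hodge datum, trace system, block assignment): `f^* = ⋀⁰ f = id` on
`H⁰ = ⋀⁰ L`. -/
theorem fact3_pull_H0 : (toyModel3With D T pl).Fact_pull_H0 := fun _ f => exteriorPower_map_zero f.lin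

/-- **N4 in `toyModel3With exteriorHodgeData T pl`**: `F⁰ (ℂ ⊗ ⋀^k L X) = ⊤` (`Obj.hodgeF_eq_top` on `X.X.toObj`). -/
theorem fact3_hodge_F0 : (toyModel3With exteriorHodgeData T pl).Fact_hodge_F0 := fun X k =>
  X.X.toObj.hodgeF_eq_top (k := k) (p := 0) le_rfl

/-! ### N1 — the cohomology ring is the exterior algebra on `H¹`, via the cup product -/

/-- The iterated cup product of `toyModel3With D T pl` on a good object `X` IS the iterated cup product of the
generation-1 model `toyModelWith D` on the expanded object `X.X.toObj` (same cohomology `⋀^• L`, same cup = wedge;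
induction on the number of factors). -/
theorem cupPow₃_eq (X : GObj) : ∀ (k : ℕ) (a : Fin (k + 1) → ↥(⋀[ℚ]^1 X.X.L)),
    (toyModel3With D T pl).cupPow X k a = (toyModelWith D).cupPow X.X.toObj k a
  | 0, _ => rfl
  | k + 1, a => by
      rw [Universe.cupPow_succ, Universe.cupPow_succ, cupPow₃_eq X k (Fin.init a)]

/-- **N1 in `toyModel3With D T pl`, for every good object** (any Hodge datum): transported from
`HodgeCM.Toy.cupExterior D X.X.toObj k` along `cupPow₃_eq`. -/
theorem cupExterior₃ (X : GObj) (k : ℕ) : (toyModel3With D T pl).CupExterior X k := by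
  obtain ⟨e, hb, he⟩ := HodgeCM.Toy.cupExterior D X.X.toObj k
  exact ⟨e, hb, fun a => (he a).trans (cupPow₃_eq D T pl X k a).symm⟩

/-- **N1 in `toyModel3With D T pl`** (the `Fact`, CM products). -/
theorem fact3_cupExterior : (toyModel3With D T pl).Fact_cupExterior := fun F _ Θ k =>
  cupExterior₃ D T pl ((toyModel3With D T pl).cmProd F Θ) k

/-! ### N2 — the cup product respects the Hodge filtration in all bidegrees -/

/-- **N2 in `toyModel3With exteriorHodgeData T pl`**: `F^p ⋀^i ∪ F^q ⋀^j ⊆ F^{p+q} ⋀^{i+j}` — the generation-1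
theorem `HodgeCM.Toy.fact_cup_hodge` at the expanded object `X.X.toObj` (the complexified cup products agree by `rfl`). -/
theorem fact3_cup_hodge : (toyModel3With exteriorHodgeData T pl).Fact_cup_hodge :=
  fun X i j p q x y hx hy => HodgeCM.Toy.fact_cup_hodge X.X.toObj i j p q x y hx hy

/-! ### M29, M30 and Pohlmann's theorem under the model axioms -/

variable {T pl}

/-- M29 `Fact_weightSpan` holds in `toyModel3With exteriorHodgeData T pl` (given its model axioms). -/
theorem toyModel3_weightSpan (M : (toyModel3With exteriorHodgeData T pl).ModelAxioms) :
    (toyModel3With exteriorHodgeData T pl).Fact_weightSpan :=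
  Universe.weightSpan_of_facts M (fact3_cupExterior exteriorHodgeData T pl) (fact3_pull_H0 exteriorHodgeData T pl)

/-- M30 `Fact_weightHodge` holds in `toyModel3With exteriorHodgeData T pl` (given its model axioms). -/
theorem toyModel3_weightHodge (M : (toyModel3With exteriorHodgeData T pl).ModelAxioms) :
    (toyModel3With exteriorHodgeData T pl).Fact_weightHodge :=
  Universe.weightHodge_of_facts M (fact3_cupExterior exteriorHodgeData T pl) (fact3_cup_hodge T pl)
    (fact3_pull_H0 exteriorHodgeData T pl) (fact3_hodge_F0 T pl)

/-- **Pohlmann's span theorem holds in `toyModel3With exteriorHodgeData T pl`** (given its model axioms): the kernel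
proof `Universe.pohlmannSpan_of_facts` run on the generation-2 universe, where N1–N4 are theorems. -/
theorem toyModel3_pohlmannSpan (M : (toyModel3With exteriorHodgeData T pl).ModelAxioms) :
    (toyModel3With exteriorHodgeData T pl).PohlmannSpan :=
  Universe.pohlmannSpan_of_facts M (fact3_cupExterior exteriorHodgeData T pl) (fact3_cup_hodge T pl)
    (fact3_pull_H0 exteriorHodgeData T pl) (fact3_hodge_F0 T pl)

/-- **`PohlmannBasis` (`B^p ⊗ ℂ = ⨆_{S Hodge} V_S`) holds in `toyModel3With exteriorHodgeData T pl`**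
(given its model axioms). -/
theorem toyModel3_pohlmannBasis (M : (toyModel3With exteriorHodgeData T pl).ModelAxioms) :
    (toyModel3With exteriorHodgeData T pl).PohlmannBasis :=
  Universe.pohlmannBasis_of_facts M (fact3_cupExterior exteriorHodgeData T pl) (fact3_cup_hodge T pl)
    (fact3_pull_H0 exteriorHodgeData T pl) (fact3_hodge_F0 T pl)

/-- **Gao–Ullmo Thm 3.1 (basis + dimension form, `p ≥ 1`) holds in `toyModel3With exteriorHodgeData T pl`**
(given its model axioms). -/
theorem toyModel3_pohlmannTheorem31 (M : (toyModel3With exteriorHodgeData T pl).ModelAxioms) :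
    (toyModel3With exteriorHodgeData T pl).PohlmannTheorem31 :=
  Universe.pohlmannTheorem31_of_facts M (fact3_cupExterior exteriorHodgeData T pl) (fact3_cup_hodge T pl)
    (fact3_pull_H0 exteriorHodgeData T pl) (fact3_hodge_F0 T pl)

/-! ### [QW8] sufficiency and the location of the open inputs -/

/-- **[QW8] Thm 2.5 (sufficiency) holds in `toyModel3With exteriorHodgeData T pl`** (given its model axioms): since
`alg =` Hodge classes there, `PohlmannBasis` puts every weight vector of a Hodge weight inside `algC` (the
Lefschetz-character hypothesis and the algebraicity of the Weil face lines are not used). -/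
theorem toyModel3_qw8Sufficiency (M : (toyModel3With exteriorHodgeData T pl).ModelAxioms) :
    (toyModel3With exteriorHodgeData T pl).Qw8Sufficiency := by
  intro F hG _h6 _hW n Θ p S x hS hx _hlef
  have hB := toyModel3_pohlmannBasis M F hG n Θ p
  change x ∈ ((toyModel3With exteriorHodgeData T pl).alg ((toyModel3With exteriorHodgeData T pl).cmProd F Θ) p).baseChange ℂ
  have halg : (toyModel3With exteriorHodgeData T pl).alg ((toyModel3With exteriorHodgeData T pl).cmProd F Θ) p =
      (toyModel3With exteriorHodgeData T pl).hodgeClassesOf ((toyModel3With exteriorHodgeData T pl).cmProd F Θ) p :=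
    rfl
  rw [halg, hB]
  exact Submodule.mem_iSup_of_mem S
    (Submodule.mem_iSup_of_mem hS ((Universe.mem_weightSpace_iff F Θ S (2 * p) x).mpr hx))

/-- **The open inputs of `toyModel3With exteriorHodgeData T pl` are exactly the two realisation statements**
(given its model axioms): `pohlmann_span` and `qw8_sufficiency` are theorems of the universe. -/
theorem toyModel3_openInputs_iff (M : (toyModel3With exteriorHodgeData T pl).ModelAxioms) :
    (toyModel3With exteriorHodgeData T pl).OpenInputs ↔
      ((toyModel3With exteriorHodgeData T pl).RealisationExistsPerL ∧
        (toyModel3With exteriorHodgeData T pl).RealisationExistsFace) :=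
  ⟨fun h => ⟨h.realisation_perL, h.realisation_face⟩,
    fun h => ⟨h.1, h.2, toyModel3_pohlmannSpan M, toyModel3_qw8Sufficiency M⟩⟩

/-- `ModelAxioms ∧ N1 ∧ N2 ∧ N3 ∧ N4` in `toyModel3With exteriorHodgeData T pl` (given `M`): the fold of N1–N4 into the
model axioms keeps this consistency witness too. -/
theorem toyModel3_axiomsN (M : (toyModel3With exteriorHodgeData T pl).ModelAxioms) :
    (toyModel3With exteriorHodgeData T pl).ModelAxioms ∧ (toyModel3With exteriorHodgeData T pl).Fact_cupExterior ∧
      (toyModel3With exteriorHodgeData T pl).Fact_cup_hodge ∧ (toyModel3With exteriorHodgeData T pl).Fact_pull_H0 ∧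
      (toyModel3With exteriorHodgeData T pl).Fact_hodge_F0 :=
  ⟨M, fact3_cupExterior exteriorHodgeData T pl, fact3_cup_hodge T pl, fact3_pull_H0 exteriorHodgeData T pl,
    fact3_hodge_F0 T pl⟩

end HodgeCM.ToyG2

end
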